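import Summits.QuantumFields.BalabanUV.Beta.CompositeCorrectorRulesSym
import Summits.QuantumFields.BalabanUV.Beta.RelInvComposite

/-!
# `BalabanUV.Beta.RelInvCompositeSym` — binder row D1 ∕ (C1), K-U3d-sym (L-e): **THE SYM TWIN OF K-U3d's (Z)_m END** — the owner's generic socket
# `RelInvCompositeSocket.relInv_composite_of_corrector'` with EVERY corrector hypothesis DISCHARGED by `CompositeCorrectorKernelSym` (spread) and `CompositeCorrectorRulesSym`
# (inverse pair, slice rules): `RelInv (Ψ̂ˢ_m ∘ G ∘ Ψ̂ˢ_mᵀ) (bhKcompSym r L m) (axEc (toSite s) (L^m))` for `G := coDressKBmAt (toSite s) (L^m) KInv`, at general `d`, `L`, root, depth.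
# ROAD-FREE (W-21 decision): the N-system INSTANCE `relInv_ANs_sym` (over road S-L1's `ANs`) is collected with the L-chart letters in `NVertexColumnK1RowSym`∕`NVertexChartSymLetters`.

WHAT ([our object] one `def` `bhKcompSym` = the congruence-bordered Hessian `(Φ̂ˢ_m)ᵀ ∘ bhK (L^m) ∘ Φ̂ˢ_m` (K-U3d `RelInvComposite.bhKcomp` with `phiK ↦ phiKSym`) + its `rfl`
unfolding; [folklore] one theorem `relInv_compositeSym`; nothing cited, 0 sorry).  WHAT THIS IS NOT: not a chart for the N-system; the (0.4) CONTENT «the congruence-bordered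
Hessian's slot rows ARE the (0.4) composite rows» is a by-value matter (SYM2 (ii) OF RECORD at (2,3)) and is NOT asserted here; 0∕4 row-D1 binders; NOT (C1), NOT (T-ID),
NOT D1, NEVER «G-an2-4 closed», NOT BetaPertH, NOT continuum, NOT Clay.

HONEST FRAMING (cell charter, verbatim): «discharging BetaPertH makes Balaban's UV stability UNCONDITIONAL — a real
constructive-QFT result; it is NOT the continuum limit and NOT the Clay problem.»
HONEST DEPENDENCY: continuum YM on T⁴ ⇐ BetaPertH ∧ nine spine estimates (0/9 proved); BetaPertH ⇐ (D1) ∧ (D4) ∧ CAP+tail;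
G-an2-4 gates asym, D1 and NE2/3/4.
ABSOLUTE RULE (cell, verbatim): «No internally-minted statement may enter as a cited fact. Every hypothesis is either kernel-proved in this
package or a verbatim quotation of a PUBLISHED theorem with page reference. The manuscript(s) under audit are NOT citable for their own
disputed steps — they are the thing under adjudication; programme-internal (2001/route/tribunal) claims are never citable.»
Row D1 ∕ (C1) OWNER an2 (b2b-balaban-beta-an2) gen 92, 2026-08-31.  No existing file touched.  STAGED ONLY (FILING PLAN FP-L F-L3); NOT proposed before the operator∕director line.
-/

namespace Summit.QuantumFields.BalabanUV.Beta.RelInvCompositeSym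

open Finset
open scoped BigOperators
open Literature.Probability.LatticeModels (Torus.proj)
open Literature.MathematicalPhysics.QuantumFieldTheory
open Literature.MathematicalPhysics.QuantumFieldTheory.Balaban1983to89
open Literature.MathematicalPhysics.QuantumFieldTheory.Balaban1983to89.Beta
open ExpKernelCalculus (MKer Decays shiftK comp)
open HessKerSchurResolvent (idK idK_apply)
open OneStepResolventKernel (Fib KInv)
open AffineAveraging (Site Form1 box toSite unitVec dz curv)
open AveragingContours (blk shift)
open Summit.QuantumFields.BalabanUV.Beta.TameKernelCalculus (Spr trK)
open Summit.QuantumFields.BalabanUV.Beta.ChartConjugationRelative (RelInv)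
open Summit.QuantumFields.BalabanUV.Beta.AxialDressingRooted (IsCombBondAt axEc comp_axEc_apply comp_axEc_apply' coDressKBmAt)
open Summit.QuantumFields.BalabanUV.Beta.BorderedHessian (bhK)
open Summit.QuantumFields.BalabanUV.Beta.CompositeCorrectorKernel (kerOf kerOf_inl_inl kerOf_inl_inr kerOf_inr_inl kerOf_inr_inr indR indR_apply
  apply_indR_eq_zero_of_not_mem kerOf_shift kerBound decays_of_blockShift_of_range psiK phiK spr_psiK spr_phiK
  comp_kerOf_inl comp_kerOf_inr comp_trK_kerOf_inl comp_trK_kerOf_inr exists_finset_corrReads)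
open Summit.QuantumFields.BalabanUV.Beta.CompositeCorrectorLocality (CorrReads)
open Summit.QuantumFields.BalabanUV.Beta.CompositeAveragingCoarseExactGeneric (corrPsiSym corrPhiSym corrPsiSym_shift corrPhiSym_shift corrPsiSym_zero
  corrPhiSym_zero depOn_corrPsiSym depOn_corrPhiSym corrPsiSym_sum_smul corrPhiSym_sum_smul corrPsiSym_corrPhiSym corrPhiSym_corrPsiSym
  corrPsiSym_apply_of_blk_eq corrPhiSym_apply_of_blk_eq)
open Summit.QuantumFields.BalabanUV.Beta.CompositeCorrectorRules (comp_psiK_phiK comp_phiK_psiK comp_comp_axEc_psiK comp_comp_axEc_phiK)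
open Summit.QuantumFields.BalabanUV.Beta.CompositeCorrectorKernelSym (psiKSym phiKSym psiKSym_inl_inl psiKSym_inl_inr psiKSym_inr_inl psiKSym_inr_inr
  phiKSym_inl_inl phiKSym_inl_inr phiKSym_inr_inl phiKSym_inr_inr spr_psiKSym spr_phiKSym comp_psiKSym_inl comp_psiKSym_inr comp_phiKSym_inl comp_phiKSym_inr
  comp_trK_psiKSym_inl comp_trK_psiKSym_inr comp_trK_phiKSym_inl comp_trK_phiKSym_inr psiKSym_eq_idK_of_blk_ne phiKSym_eq_idK_of_blk_ne)
open Summit.QuantumFields.BalabanUV.Beta.RelInvCompositeSocket (relInv_composite_of_corrector relInv_composite_of_corrector')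
open Summit.QuantumFields.BalabanUV.Beta.RelInvComposite (bhKcomp relInv_composite)
open Summit.QuantumFields.BalabanUV.Beta.CompositeCorrectorRulesSym (comp_psiKSym_phiKSym comp_phiKSym_psiKSym comp_comp_axEc_psiKSym comp_comp_axEc_phiKSym)

noncomputable section

variable {d : ℕ}

/-! ## §1 The congruence-bordered Hessian at the sym corrector -/

/-- [our object — bookkeeping] **`bhKcompSym r L m := Φ̂ˢ_mᵀ ∘ bhK (L^m) ∘ Φ̂ˢ_m`** — `RelInvComposite.bhKcomp` with `phiK ↦ phiKSym` (the congruence-defined re-linearised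
bordered operator; that its slot rows ARE the (0.4) composite rows is (L-k4), NOT asserted here). -/
def bhKcompSym (r : ℕ → (Fin (d + 1) → ℕ)) (L m : ℕ) : MKer (d + 1) (Fib d) :=
  comp (comp (trK (phiKSym r L m)) (bhK (L ^ m))) (phiKSym r L m)

/-- [folklore] Unfolding of `bhKcompSym` (`rfl`). -/
theorem bhKcompSym_eq (r : ℕ → (Fin (d + 1) → ℕ)) (L m : ℕ) :
    bhKcompSym r L m = comp (comp (trK (phiKSym r L m)) (bhK (L ^ m))) (phiKSym r L m) := rfl

/-! ## §2 THE SYM TWIN OF K-U3d's (Z)_m END (`RelInvComposite.relInv_composite`): the owner's socket with EVERY corrector hypothesis discharged BY NAME -/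

section End

/-- [folklore] **`relInv_compositeSym` — THE (Z)_m END AT THE (0.4)-COMPOSITE CORRECTOR PAIR.**  The `Ψ̂ˢ_m`-congruent co-dressed one-shot resolvent
`Ψ̂ˢ_m ∘ coDressKBmAt (toSite s) (L^m) (KInv (L^m)) ∘ Ψ̂ˢ_mᵀ` is a relative inverse of the `Φ̂ˢ_m`-congruent bordered Hessian `bhKcompSym r L m = Φ̂ˢ_mᵀ ∘ bhK (L^m) ∘ Φ̂ˢ_m`
on the range of the coarse axial coordinate projector `axEc (toSite s) (L^m)` — `RelInvCompositeSocket.relInv_composite_of_corrector'` fed §2 (`spr_psiKSym`, `spr_phiKSym`),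
§3 (`comp_psiKSym_phiKSym`, `comp_phiKSym_psiKSym`) and §4 (`comp_comp_axEc_psiKSym`, `comp_comp_axEc_phiKSym`): NO displayed letter. -/
theorem relInv_compositeSym {L : ℕ} (hL : 0 < L) (r : ℕ → (Fin (d + 1) → ℕ)) (hr : ∀ k, r k ∈ box (d + 1) L) {m : ℕ} {s : Fin (d + 1) → ℕ}
    (hs : s ∈ box (d + 1) (L ^ m)) [NeZero (L ^ m)] :
    RelInv (comp (comp (psiKSym r L m) (coDressKBmAt (toSite s) (L ^ m) (KInv (N := L ^ m) (d := d)))) (trK (psiKSym r L m)))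
      (bhKcompSym r L m) (axEc (toSite s) (L ^ m)) :=
  relInv_composite_of_corrector' hs (spr_psiKSym hL hr m) (spr_phiKSym hL hr m) (comp_psiKSym_phiKSym hL r hr m) (comp_phiKSym_psiKSym hL r hr m)
    (comp_comp_axEc_psiKSym r L m hs) (comp_comp_axEc_phiKSym r L m hs) (bhKcompSym_eq r L m)

/-- (II) CONTROL [folklore]: at the ROOTED pair `psiK ∕ phiK` the same END is the tree's `RelInvComposite.relInv_composite` (K-U3d L4, an2 g24). -/
example {L : ℕ} (hL : 0 < L) (r : ℕ → (Fin (d + 1) → ℕ)) (hr : ∀ k, r k ∈ box (d + 1) L) {m : ℕ} {s : Fin (d + 1) → ℕ}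
    (hs : s ∈ box (d + 1) (L ^ m)) [NeZero (L ^ m)] :
    RelInv (comp (comp (psiK r L m) (coDressKBmAt (toSite s) (L ^ m) (KInv (N := L ^ m) (d := d)))) (trK (psiK r L m)))
      (bhKcomp r L m) (axEc (toSite s) (L ^ m)) :=
  relInv_composite hL r hr hs

end End

end

end Summit.QuantumFields.BalabanUV.Beta.RelInvCompositeSym
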